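import Summits.MatrixMultiplication.MatrixMultiplication.Theorems.FarEdgeDescentSpectralShadow
import Summits.MatrixMultiplication.MatrixMultiplication.Theorems.FarEdgeDescentTower
import Literature.Computability.AlgebraicComplexity.RectangularExponentSubadditivity
import Literature.Computability.AlgebraicComplexity.RectangularExponentSymmetry
import Literature.Computability.AlgebraicComplexity.RectangularExponentInformationBound
import HarnessLib

/-!
# Route `SaturationLadder` on Strassen's spectrum, I: the THIN ROOF and the high-point law (every field)

decomp-mm lens 1 «grading / quantitative ladder», gen 43, kernel K43-A.  Support module (def-free, sorry-free,
THESES-FREE: imports `Literature` and two landed `Theorems` modules only) beneath the deciding crux `SubexpSaturation`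
(stmt-MatrixMultiplication-25909) of `route-MatrixMultiplication-SaturationLadder`; cut of record UNCHANGED:
`closes (h₁ : SubexpSaturation) (h₂ : SubexpToPoly) (h₃ : PolyToFinite) (h₄ : TailDescentTwo) (h₅ : SquareFromTwo)`.
Write `θ = (θ₀,θ₁,θ₂) = specMMPoint K φ ∈ [0,1]³` (Alman–Li 2026, Prop. 4.1/4.2) for a universal spectral point `φ`,
`εᵢ = 1 − θᵢ` (DEPTHS), `d = θ₀+θ₁+θ₂−2` (DARKNESS).  The crux's currency is the THIN tight point `ω(1,t,r) = 1+r`.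
Over EVERY field:
* §1 the exponent is the SUPPORT FUNCTION of the spectrum on the whole real plane of formats `(1,x,y)`:
  `θ₀ + x·θ₁ + y·θ₂ ≤ ω(1,x,y)` (`x, y ≥ 0`; `plane_le_omegaRect`) with equality in the supremum (`isLUB_plane`) — the
  two-parameter extension of the middle pencil of `FarEdgeDescentSpectralShadow` (Strassen duality on power-of-two
  formats, rational approximation, Lotti–Romani's `1`-Lipschitz estimate in two slots);
* §2 **THE THIN ROOF** `ω(1,t,r) ≤ 1+r ⟺ ∀φ: t·θ₁ ≤ ε₀ + r·ε₂` (`thinTight_iff_roof`): the weighted height is paid for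
  by the first depth plus `r` times the third.  Readings: summit = unit roof `θ₁ ≤ ε₀ + ε₂` (no dark point, lens 2's
  `omega_eq_two_iff_noDark`); far tight point `E_k` = FACE law `θ₁ ≤ ε₀ + k·ε₂` at the light face `{θ₂ = 1}`
  (`farTight_iff_roof`); near plateau `ω(1,a,1) = 2 ⟺ a·θ₁ ≤ ε₀ + ε₂` (`plateau_iff_roof`); two-parameter exactness
  `ω(1,x,y) = x+y ⟺ ∀φ: d ≤ (x−1)ε₁ + (y−1)ε₂` (`exact_iff_roof₂`) interpolates lens 2's near and far cones;
* §3 **HIGH POINTS OBEY EVERY SUBEXPONENTIAL ROOF, unconditionally**: the landed far-edge tower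
  (`FarEdgeDescentTower.excess_le_inv_two_pow`, every field) read in the third slot (`height_le_tower`:
  `θ₁ ≤ ε₀ + 3·15^j·ε₂ + 2^{−j}`) gives, for `0 < η ≤ 1`, `c > 0`, `0 < s ≤ min 1 (c⁵η⁴/92160)` and every universal
  spectral point of height `θ₁ ≥ η`: **`(1−s)·θ₁ ≤ ε₀ + exp(c/s)·ε₂`** (`highRoof_subexp`, `highRoof_subexp_t`), and the
  polynomial roof `(1−s)·θ₁ ≤ ε₀ + (768/(η⁴s⁴))·ε₂` for `0 < s ≤ 1` (`highRoof_poly`).  With `s = 1−t` these are the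
  spectral clauses of `SubexpSaturation` / `PolySaturation`: the crux's open content sits at spectral points of
  VANISHING height, near the gauge corner `(1,0,1)` (chain file II, `SaturationLadderCornerGerm`).
No definitions (gate rule D-0009).  Nothing here proves `ω = 2` or the crux.  [cite: Strassen1988, Thm. 3.8]
[cite: AlmanLi2026, Proposition 4.1; Proposition 4.2] [cite: LottiRomani1983, Thm. 2; Prop. 4.1]
[cite: ChristandlVranaZuiddam2023, Prop. 1.6] [cite: CoppersmithWinograd1982, Thm. 1] [cite: Coppersmith1982, Thm. 1] -/

set_option linter.dupNamespace false

noncomputable section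

open scoped BigOperators

namespace Summit.MatrixMultiplication.MatrixMultiplication.Theorems.SaturationLadderThinRoof

open Literature.Computability.AlgebraicComplexity
open Summit.MatrixMultiplication.MatrixMultiplication.Theorems.FarEdgeDescentSpectralShadow
  (line_le_omegaRect_div exists_carrier_div sum_three)
open Summit.MatrixMultiplication.MatrixMultiplication.Theorems.FarEdgeDescentTower (excess_le_inv_two_pow)

variable {K : Type} [Field K]

/-! ## §1 The support function of the spectrum on the real plane of formats `(1, x, y)` -/

/-- The plane at a rational point: `θ₀ + (p/d)θ₁ + (q/d)θ₂ ≤ ω(1, p/d, q/d)`. [cite: Strassen1988, Thm. 3.8] -/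
theorem plane_le_omegaRect_rat {F : SpectralMap K} (hF : IsUniversalSpectralPoint K F) (p q : ℕ)
    {d : ℕ} (hd : 1 ≤ d) :
    specMMPoint K F 0 + (p : ℝ) / d * specMMPoint K F 1 + (q : ℝ) / d * specMMPoint K F 2 ≤
      omegaRect K 1 ((p : ℝ) / d) ((q : ℝ) / d) := by
  have hdpos : (0 : ℝ) < d := by exact_mod_cast (by omega : 0 < d)
  have h := line_le_omegaRect_div hF d p q hd
  rw [div_self hdpos.ne'] at h
  have e : ((d : ℝ) * specMMPoint K F 0 + p * specMMPoint K F 1 + q * specMMPoint K F 2) / d =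
      specMMPoint K F 0 + (p : ℝ) / d * specMMPoint K F 1 + (q : ℝ) / d * specMMPoint K F 2 := by
    field_simp
  rwa [e] at h

/-- Every rational point of the plane is CARRIED: `θ₀ + (p/d)θ₁ + (q/d)θ₂ = ω(1, p/d, q/d)` for some universal
spectral point. [cite: Strassen1988, Thm. 3.8] [cite: ChristandlVranaZuiddam2023, Prop. 1.6] -/
theorem exists_carrier_rat (p q : ℕ) {d : ℕ} (hd : 1 ≤ d) :
    ∃ F : SpectralMap K, IsUniversalSpectralPoint K F ∧
      specMMPoint K F 0 + (p : ℝ) / d * specMMPoint K F 1 + (q : ℝ) / d * specMMPoint K F 2 =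
        omegaRect K 1 ((p : ℝ) / d) ((q : ℝ) / d) := by
  have hdpos : (0 : ℝ) < d := by exact_mod_cast (by omega : 0 < d)
  obtain ⟨F, hF, h⟩ := exists_carrier_div (K := K) d p q hd
  refine ⟨F, hF, ?_⟩
  rw [div_self hdpos.ne'] at h
  have e : ((d : ℝ) * specMMPoint K F 0 + p * specMMPoint K F 1 + q * specMMPoint K F 2) / d =
      specMMPoint K F 0 + (p : ℝ) / d * specMMPoint K F 1 + (q : ℝ) / d * specMMPoint K F 2 := by
    field_simp
  rwa [e] at h

/-- ★ **The spectral planes lie below the exponent on the whole real plane of formats**: for real `x, y ≥ 0` and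
every universal spectral point, `θ₀ + x·θ₁ + y·θ₂ ≤ ω(1, x, y)` (rational approximation from above in both slots,
`θ₁, θ₂ ≥ 0`, and the two-slot `1`-Lipschitz estimate `ω(1,x',y') ≤ ω(1,x,y) + (x'−x) + (y'−y)`).
[cite: Strassen1988, Thm. 3.8] [cite: LottiRomani1983, Thm. 2] -/
theorem plane_le_omegaRect {F : SpectralMap K} (hF : IsUniversalSpectralPoint K F) {x y : ℝ}
    (hx : 0 ≤ x) (hy : 0 ≤ y) :
    specMMPoint K F 0 + x * specMMPoint K F 1 + y * specMMPoint K F 2 ≤ omegaRect K 1 x y := by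
  have hθ1 := (AlmanLi2026.prop42_mem_Icc hF 1).1
  have hθ2 := (AlmanLi2026.prop42_mem_Icc hF 2).1
  refine le_of_forall_pos_lt_add fun δ hδ => ?_
  obtain ⟨d, hd⟩ := exists_nat_one_div_lt (half_pos hδ)
  set D : ℕ := d + 1 with hD
  have hD1 : 1 ≤ D := by omega
  have hDpos : (0 : ℝ) < D := by exact_mod_cast (by omega : 0 < D)
  set p : ℕ := ⌊x * D⌋₊ + 1 with hp
  set q : ℕ := ⌊y * D⌋₊ + 1 with hq
  have hxp : x ≤ (p : ℝ) / D := by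
    rw [le_div_iff₀ hDpos, hp]
    push_cast
    exact (Nat.lt_floor_add_one (x * D)).le
  have hpx : (p : ℝ) / D ≤ x + 1 / D := by
    rw [div_le_iff₀ hDpos, hp, add_mul, one_div_mul_cancel hDpos.ne']
    push_cast
    have := Nat.floor_le (mul_nonneg hx hDpos.le)
    linarith
  have hyq : y ≤ (q : ℝ) / D := by
    rw [le_div_iff₀ hDpos, hq]
    push_cast
    exact (Nat.lt_floor_add_one (y * D)).le
  have hqy : (q : ℝ) / D ≤ y + 1 / D := by
    rw [div_le_iff₀ hDpos, hq, add_mul, one_div_mul_cancel hDpos.ne']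
    push_cast
    have := Nat.floor_le (mul_nonneg hy hDpos.le)
    linarith
  have h1 := plane_le_omegaRect_rat hF p q hD1
  have h2 : omegaRect K 1 ((p : ℝ) / D) ((q : ℝ) / D) ≤
      omegaRect K 1 x y + ((p : ℝ) / D - x) + ((q : ℝ) / D - y) := by
    have h := omegaRect_add_le_add_pos K 1 x y 0 ((p : ℝ) / D - x) ((q : ℝ) / D - y)
    have ex : x + ((p : ℝ) / D - x) = (p : ℝ) / D := by ring
    have ey : y + ((q : ℝ) / D - y) = (q : ℝ) / D := by ring
    rw [add_zero, ex, ey, max_self, max_eq_left (sub_nonneg.2 hxp), max_eq_left (sub_nonneg.2 hyq)] at h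
    linarith
  have h3 : x * specMMPoint K F 1 ≤ (p : ℝ) / D * specMMPoint K F 1 :=
    mul_le_mul_of_nonneg_right hxp hθ1
  have h4 : y * specMMPoint K F 2 ≤ (q : ℝ) / D * specMMPoint K F 2 :=
    mul_le_mul_of_nonneg_right hyq hθ2
  have h5 : (1 : ℝ) / D = 1 / ((d : ℝ) + 1) := by rw [hD]; push_cast; ring
  linarith

/-- ★ **The exponent is the least upper bound of the spectral planes** at every real `x, y ≥ 0`:
`ω(1,x,y) = sup_φ (θ₀ + x·θ₁ + y·θ₂)` — Strassen duality `R̃ = max_φ φ` read on the plane (carriers of the rational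
points `(⌊xD⌋/D, ⌊yD⌋/D) ↑ (x,y)` and two-slot Lipschitz continuity). [cite: Strassen1988, Thm. 3.8]
[cite: AlmanLi2026, Proposition 4.1] -/
theorem isLUB_plane {x y : ℝ} (hx : 0 ≤ x) (hy : 0 ≤ y) :
    IsLUB ((fun F : SpectralMap K =>
        specMMPoint K F 0 + x * specMMPoint K F 1 + y * specMMPoint K F 2) '' {F | IsUniversalSpectralPoint K F})
      (omegaRect K 1 x y) := by
  refine ⟨?_, ?_⟩
  · rintro _ ⟨F, hF, rfl⟩
    exact plane_le_omegaRect hF hx hy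
  · intro b hb
    refine le_of_forall_pos_lt_add fun δ hδ => ?_
    obtain ⟨d, hd⟩ := exists_nat_one_div_lt (half_pos hδ)
    set D : ℕ := d + 1 with hD
    have hD1 : 1 ≤ D := by omega
    have hDpos : (0 : ℝ) < D := by exact_mod_cast (by omega : 0 < D)
    set p : ℕ := ⌊x * D⌋₊ with hp
    set q : ℕ := ⌊y * D⌋₊ with hq
    have hpx : (p : ℝ) / D ≤ x := by
      rw [div_le_iff₀ hDpos, hp]
      exact Nat.floor_le (mul_nonneg hx hDpos.le)
    have hxp : x ≤ (p : ℝ) / D + 1 / D := by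
      rw [← add_div, le_div_iff₀ hDpos, hp]
      exact (Nat.lt_floor_add_one (x * D)).le
    have hqy : (q : ℝ) / D ≤ y := by
      rw [div_le_iff₀ hDpos, hq]
      exact Nat.floor_le (mul_nonneg hy hDpos.le)
    have hyq : y ≤ (q : ℝ) / D + 1 / D := by
      rw [← add_div, le_div_iff₀ hDpos, hq]
      exact (Nat.lt_floor_add_one (y * D)).le
    obtain ⟨F, hF, hcar⟩ := exists_carrier_rat (K := K) p q hD1
    have hθ1 := (AlmanLi2026.prop42_mem_Icc hF 1).1
    have hθ2 := (AlmanLi2026.prop42_mem_Icc hF 2).1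
    have hbF : specMMPoint K F 0 + x * specMMPoint K F 1 + y * specMMPoint K F 2 ≤ b := hb ⟨F, hF, rfl⟩
    have h2 : omegaRect K 1 x y ≤
        omegaRect K 1 ((p : ℝ) / D) ((q : ℝ) / D) + (x - (p : ℝ) / D) + (y - (q : ℝ) / D) := by
      have h := omegaRect_add_le_add_pos K 1 ((p : ℝ) / D) ((q : ℝ) / D) 0 (x - (p : ℝ) / D) (y - (q : ℝ) / D)
      have ex : (p : ℝ) / D + (x - (p : ℝ) / D) = x := by ring
      have ey : (q : ℝ) / D + (y - (q : ℝ) / D) = y := by ring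
      rw [add_zero, ex, ey, max_self, max_eq_left (sub_nonneg.2 hpx), max_eq_left (sub_nonneg.2 hqy)] at h
      linarith
    have h3 : (p : ℝ) / D * specMMPoint K F 1 ≤ x * specMMPoint K F 1 :=
      mul_le_mul_of_nonneg_right hpx hθ1
    have h4 : (q : ℝ) / D * specMMPoint K F 2 ≤ y * specMMPoint K F 2 :=
      mul_le_mul_of_nonneg_right hqy hθ2
    have h5 : (1 : ℝ) / D = 1 / ((d : ℝ) + 1) := by rw [hD]; push_cast; ring
    linarith

/-! ## §2 The thin roof -/

/-- ★★ **THE THIN ROOF**: for real `t, r ≥ 0`, the thin format `(1,t,r)` is tight, `ω(1,t,r) ≤ 1 + r`, if and only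
if at every universal spectral point the weighted height is paid for by the two depths,
`t·θ₁ ≤ (1 − θ₀) + r·(1 − θ₂)`.  (The reverse inequality `1 + r ≤ ω(1,t,r)` always holds: `add_le_omegaRect₁₃`.)
[cite: Strassen1988, Thm. 3.8] [cite: LottiRomani1983, Thm. 2] -/
theorem thinTight_iff_roof {t r : ℝ} (ht : 0 ≤ t) (hr : 0 ≤ r) :
    omegaRect K 1 t r ≤ 1 + r ↔
      ∀ F : SpectralMap K, IsUniversalSpectralPoint K F →
        t * specMMPoint K F 1 ≤ (1 - specMMPoint K F 0) + r * (1 - specMMPoint K F 2) := by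
  constructor
  · intro h F hF
    have := plane_le_omegaRect hF ht hr
    linarith
  · intro h
    refine (isLUB_plane (K := K) ht hr).2 ?_
    rintro _ ⟨F, hF, rfl⟩
    have := h F hF
    show specMMPoint K F 0 + t * specMMPoint K F 1 + r * specMMPoint K F 2 ≤ 1 + r
    linarith

/-- The thin roof, equality form: `ω(1,t,r) = 1 + r ⟺ ∀φ: t·θ₁ ≤ ε₀ + r·ε₂` (`t, r ≥ 0`).
[cite: Strassen1988, Thm. 3.8] [cite: LottiRomani1983, Thm. 1] -/
theorem thinExact_iff_roof {t r : ℝ} (ht : 0 ≤ t) (hr : 0 ≤ r) :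
    omegaRect K 1 t r = 1 + r ↔
      ∀ F : SpectralMap K, IsUniversalSpectralPoint K F →
        t * specMMPoint K F 1 ≤ (1 - specMMPoint K F 0) + r * (1 - specMMPoint K F 2) := by
  rw [← thinTight_iff_roof (K := K) ht hr]
  exact ⟨fun h => h.le, fun h => le_antisymm h (add_le_omegaRect₁₃ K 1 t r)⟩

/-- **Roofs are monotone in the length and antitone in the weight**: if `t'·θ₁ ≤ ε₀ + r'·ε₂` pointwise with
`t ≤ t'`, `r' ≤ r`, then `t·θ₁ ≤ ε₀ + r·ε₂` (`θ₁ ≥ 0`, `ε₂ ≥ 0`). [cite: AlmanLi2026, Proposition 4.2] -/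
theorem roof_mono {F : SpectralMap K} (hF : IsUniversalSpectralPoint K F) {t t' r r' : ℝ} (htt : t ≤ t')
    (hrr : r' ≤ r)
    (h : t' * specMMPoint K F 1 ≤ (1 - specMMPoint K F 0) + r' * (1 - specMMPoint K F 2)) :
    t * specMMPoint K F 1 ≤ (1 - specMMPoint K F 0) + r * (1 - specMMPoint K F 2) := by
  have hθ1 := (AlmanLi2026.prop42_mem_Icc hF 1).1
  have hε2 : 0 ≤ 1 - specMMPoint K F 2 := sub_nonneg.2 (AlmanLi2026.prop42_mem_Icc hF 2).2
  have h1 : t * specMMPoint K F 1 ≤ t' * specMMPoint K F 1 := mul_le_mul_of_nonneg_right htt hθ1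
  have h2 : r' * (1 - specMMPoint K F 2) ≤ r * (1 - specMMPoint K F 2) := mul_le_mul_of_nonneg_right hrr hε2
  linarith

/-- **Far tight points are FACE laws** (third-slot reading): for real `k ≥ 0`, `ω(1,k,1) ≤ k + 1 ⟺ ∀φ:
θ₁ ≤ ε₀ + k·ε₂` — the pinch at the light face `{θ₂ = 1}`; by `ω(1,k,1) = ω(1,1,k)` this is the thin roof at
`t = 1`.  (Lens 2's `FarEdgeDescentSpectralShadow.saturated_iff_farCone` is the middle-slot reading `d ≤ (k−1)ε₁`.)
[cite: Strassen1988, Thm. 3.8] [cite: LottiRomani1983, Thm. 1] -/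
theorem farTight_iff_roof {k : ℝ} (hk : 0 ≤ k) :
    omegaRect K 1 k 1 ≤ k + 1 ↔
      ∀ F : SpectralMap K, IsUniversalSpectralPoint K F →
        specMMPoint K F 1 ≤ (1 - specMMPoint K F 0) + k * (1 - specMMPoint K F 2) := by
  rw [omegaRect_swap₂₃ K 1 k 1, add_comm k 1, thinTight_iff_roof (K := K) zero_le_one hk]
  simp only [one_mul]

/-- **The near plateau is the roof of length one**: for real `a ≥ 0`, `ω(1,a,1) = 2 ⟺ ∀φ: a·θ₁ ≤ ε₀ + ε₂`
(equivalently `d ≤ (1−a)·θ₁`, lens 2's `plateau_iff_nearCone`). [cite: Coppersmith1982, Thm. 1]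
[cite: Strassen1988, Thm. 3.8] -/
theorem plateau_iff_roof {a : ℝ} (ha : 0 ≤ a) :
    omegaRect K 1 a 1 = 2 ↔
      ∀ F : SpectralMap K, IsUniversalSpectralPoint K F →
        a * specMMPoint K F 1 ≤ (1 - specMMPoint K F 0) + (1 - specMMPoint K F 2) := by
  rw [show (2 : ℝ) = 1 + 1 by norm_num, thinExact_iff_roof (K := K) ha zero_le_one]
  simp only [one_mul]

/-- **Two-parameter exactness is a pair of cones**: for real `x, y ≥ 0`, `ω(1,x,y) = x + y ⟺ ∀φ:
d ≤ (x−1)·ε₁ + (y−1)·ε₂` (`d = θ₀+θ₁+θ₂−2`, `εᵢ = 1−θᵢ`) — at `y = 1` the middle pencil's far cone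
`d ≤ (x−1)ε₁`, at `x = 1` the far cone of the third slot, at `x = y = 1` «no dark point».
[cite: Strassen1988, Thm. 3.8] [cite: LottiRomani1983, Thm. 1] -/
theorem exact_iff_roof₂ {x y : ℝ} (hx : 0 ≤ x) (hy : 0 ≤ y) :
    omegaRect K 1 x y = x + y ↔
      ∀ F : SpectralMap K, IsUniversalSpectralPoint K F →
        (∑ i, specMMPoint K F i) - 2 ≤ (x - 1) * (1 - specMMPoint K F 1) + (y - 1) * (1 - specMMPoint K F 2) := by
  have hlow := add_le_omegaRect₂₃ K 1 x y
  constructor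
  · intro h F hF
    have := plane_le_omegaRect hF hx hy
    rw [sum_three]
    nlinarith [this, h.le]
  · intro h
    refine le_antisymm ((isLUB_plane (K := K) hx hy).2 ?_) hlow
    rintro _ ⟨F, hF, rfl⟩
    have := h F hF
    rw [sum_three] at this
    show specMMPoint K F 0 + x * specMMPoint K F 1 + y * specMMPoint K F 2 ≤ x + y
    nlinarith [this]

/-! ## §3 High points obey every subexponential roof (unconditional) -/

/-- **The far excess pays for the height** (third-slot reading of `ω(1,k,1) = ω(1,1,k)`): for real `k ≥ 0` and every
universal spectral point, `θ₁ ≤ ε₀ + k·ε₂ + e(k)`, `e(k) := ω(1,k,1) − (k+1)`. [cite: Strassen1988, Thm. 3.8]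
[cite: LottiRomani1983, Thm. 1] -/
theorem height_le_of_farExcess {F : SpectralMap K} (hF : IsUniversalSpectralPoint K F) {k : ℝ} (hk : 0 ≤ k) :
    specMMPoint K F 1 ≤ (1 - specMMPoint K F 0) + k * (1 - specMMPoint K F 2) + (omegaRect K 1 k 1 - (k + 1)) := by
  have h := plane_le_omegaRect hF zero_le_one hk
  rw [← omegaRect_swap₂₃ K 1 k 1] at h
  linarith

/-- **The tower pays for the height**: for every `j` and every universal spectral point,
`θ₁ ≤ ε₀ + 3·15^j·ε₂ + 2^{−j}` (stage `j` of the far-edge tower `e(3·15^j) ≤ 2^{−j}`, every field).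
[cite: LottiRomani1983, Prop. 4.1] [cite: CoppersmithWinograd1982, Thm. 1] -/
theorem height_le_tower {F : SpectralMap K} (hF : IsUniversalSpectralPoint K F) (j : ℕ) :
    specMMPoint K F 1 ≤ (1 - specMMPoint K F 0) + 3 * (15 : ℝ) ^ j * (1 - specMMPoint K F 2) + 1 / (2 : ℝ) ^ j := by
  have hk : (0 : ℝ) ≤ 3 * (15 : ℝ) ^ j := by positivity
  have h1 := height_le_of_farExcess hF hk
  have h2 := excess_le_inv_two_pow K j (k := 3 * (15 : ℝ) ^ j) (by linarith)
  linarith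

/-- Arithmetic of scales, polynomial budget: for `0 < η ≤ 1` and `0 < s ≤ 1` there is a dyadic stage `j` with
`2^{−j} ≤ η·s` and `3·15^j ≤ 768/(η⁴s⁴)` (`j = ⌊log₂⌈1/(ηs)⌉⌋ + 1`, `15^j ≤ 16^j = (2^j)^4 ≤ (4/(ηs))^4`). [folklore] -/
theorem exists_dyadic_scale_poly {η s : ℝ} (hη : 0 < η) (hη1 : η ≤ 1) (hs : 0 < s) (hs1 : s ≤ 1) :
    ∃ j : ℕ, 1 / (2 : ℝ) ^ j ≤ η * s ∧ 3 * (15 : ℝ) ^ j ≤ 768 / (η ^ 4 * s ^ 4) := by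
  have hηs : 0 < η * s := mul_pos hη hs
  have hηs1 : η * s ≤ 1 := by nlinarith
  have hinv1 : 1 ≤ (η * s)⁻¹ := (one_le_inv₀ hηs).2 hηs1
  set n : ℕ := ⌈(η * s)⁻¹⌉₊ with hn
  have hn1 : (η * s)⁻¹ ≤ n := Nat.le_ceil _
  have hnup : (n : ℝ) < (η * s)⁻¹ + 1 := Nat.ceil_lt_add_one (inv_nonneg.2 hηs.le)
  have hn0 : n ≠ 0 := by
    intro h0
    have : (n : ℝ) = 0 := by exact_mod_cast h0
    linarith
  set j : ℕ := Nat.log 2 n + 1 with hj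
  have hlt : n < 2 ^ j := Nat.lt_pow_succ_log_self one_lt_two n
  have hle : 2 ^ (j - 1) ≤ n := by
    rw [hj, Nat.add_sub_cancel]
    exact Nat.pow_log_le_self 2 hn0
  have hltR : (n : ℝ) < (2 : ℝ) ^ j := by exact_mod_cast hlt
  have hleR : (2 : ℝ) ^ (j - 1) ≤ n := by exact_mod_cast hle
  have h2pow : (2 : ℝ) ^ j = 2 * (2 : ℝ) ^ (j - 1) := by
    rw [hj, Nat.add_sub_cancel, pow_succ]; ring
  refine ⟨j, ?_, ?_⟩
  · -- `(ηs)⁻¹ ≤ n < 2^j`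
    rw [div_le_iff₀ (by positivity : (0 : ℝ) < (2 : ℝ) ^ j)]
    calc (1 : ℝ) = η * s * (η * s)⁻¹ := by field_simp
      _ ≤ η * s * (2 : ℝ) ^ j := mul_le_mul_of_nonneg_left (hn1.trans hltR.le) hηs.le
  · -- `2^j ≤ 2n < 2((ηs)⁻¹ + 1) ≤ 4(ηs)⁻¹`, `15^j ≤ (2^j)^4`
    have h2j : (2 : ℝ) ^ j ≤ 4 * (η * s)⁻¹ := by rw [h2pow]; linarith
    have h15 : (15 : ℝ) ^ j ≤ ((2 : ℝ) ^ j) ^ 4 := by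
      rw [← pow_mul, mul_comm, pow_mul]
      exact pow_le_pow_left₀ (by norm_num) (by norm_num) j
    have hx4 : ((2 : ℝ) ^ j) ^ 4 ≤ (4 * (η * s)⁻¹) ^ 4 := pow_le_pow_left₀ (by positivity) h2j 4
    have e2 : (768 : ℝ) / (η ^ 4 * s ^ 4) = 3 * (4 * (η * s)⁻¹) ^ 4 := by
      field_simp
      ring
    rw [e2]
    linarith

/-- Arithmetic of scales, exponential budget: for `0 < η ≤ 1`, `c > 0` and `0 < s ≤ 1` with `92160·s ≤ c⁵η⁴`
there is a dyadic stage `j` with `2^{−j} ≤ η·s` and `3·15^j ≤ exp(c/s)` (`3·15^j ≤ 768/(ηs)⁴ ≤ (c/s)⁵/5! ≤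
exp(c/s)`). [folklore] -/
theorem exists_dyadic_scale {η c s : ℝ} (hη : 0 < η) (hη1 : η ≤ 1) (hc : 0 < c) (hs : 0 < s) (hs1 : s ≤ 1)
    (hsc : 92160 * s ≤ c ^ 5 * η ^ 4) :
    ∃ j : ℕ, 1 / (2 : ℝ) ^ j ≤ η * s ∧ 3 * (15 : ℝ) ^ j ≤ Real.exp (c / s) := by
  obtain ⟨j, hj1, hj2⟩ := exists_dyadic_scale_poly hη hη1 hs hs1
  refine ⟨j, hj1, hj2.trans ?_⟩
  have h5 := Real.pow_div_factorial_le_exp (x := c / s) (by positivity) 5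
  have hfact : ((Nat.factorial 5 : ℕ) : ℝ) = 120 := by norm_num [Nat.factorial]
  rw [hfact] at h5
  refine le_trans ?_ h5
  rw [div_pow, div_div, div_le_div_iff₀ (by positivity) (by positivity)]
  -- `768 · (s⁵ · 120) ≤ c⁵ · (η⁴ · s⁴)`
  have h4 : (0 : ℝ) ≤ s ^ 4 := by positivity
  nlinarith [mul_le_mul_of_nonneg_right hsc h4]

/-- ★★ **HIGH POINTS OBEY EVERY SUBEXPONENTIAL ROOF** (unconditional, every field): for `0 < η ≤ 1`, `c > 0` and
every scale `0 < s ≤ 1` with `92160·s ≤ c⁵η⁴`, every universal spectral point of height `θ₁ ≥ η` satisfies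
`(1 − s)·θ₁ ≤ (1 − θ₀) + exp(c/s)·(1 − θ₂)` — the spectral clause of `SubexpSaturation` at weight `t = 1−s`, for
EVERY constant `c`.  (Stage `j` of the tower with `2^{−j} ≤ ηs ≤ sθ₁` and `3·15^j ≤ exp(c/s)`.)  The crux's open
content is therefore confined to points of vanishing height (chain file II). [cite: LottiRomani1983, Prop. 4.1]
[cite: CoppersmithWinograd1982, Thm. 1] [cite: Strassen1988, Thm. 3.8] -/
theorem highRoof_subexp {η c s : ℝ} (hη : 0 < η) (hη1 : η ≤ 1) (hc : 0 < c) (hs : 0 < s) (hs1 : s ≤ 1)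
    (hsc : 92160 * s ≤ c ^ 5 * η ^ 4) {F : SpectralMap K} (hF : IsUniversalSpectralPoint K F)
    (hhigh : η ≤ specMMPoint K F 1) :
    (1 - s) * specMMPoint K F 1 ≤ (1 - specMMPoint K F 0) + Real.exp (c / s) * (1 - specMMPoint K F 2) := by
  obtain ⟨j, hj1, hj2⟩ := exists_dyadic_scale hη hη1 hc hs hs1 hsc
  have h := height_le_tower hF j
  have hε2 : 0 ≤ 1 - specMMPoint K F 2 := sub_nonneg.2 (AlmanLi2026.prop42_mem_Icc hF 2).2
  have h3 : 3 * (15 : ℝ) ^ j * (1 - specMMPoint K F 2) ≤ Real.exp (c / s) * (1 - specMMPoint K F 2) :=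
    mul_le_mul_of_nonneg_right hj2 hε2
  have h4 : η * s ≤ s * specMMPoint K F 1 := by nlinarith [mul_le_mul_of_nonneg_left hhigh hs.le]
  nlinarith [h, h3, h4, hj1]

/-- ★ **HIGH POINTS OBEY A POLYNOMIAL ROOF** (unconditional, every field): for `0 < η ≤ 1` and `0 < s ≤ 1`, every
universal spectral point of height `θ₁ ≥ η` satisfies `(1 − s)·θ₁ ≤ (1 − θ₀) + (768/(η⁴s⁴))·(1 − θ₂)` — the
spectral clause of `PolySaturation` (`C = 768/η⁴`, `k = 4`) at weight `t = 1−s`.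
[cite: LottiRomani1983, Prop. 4.1] [cite: CoppersmithWinograd1982, Thm. 1] [cite: Strassen1988, Thm. 3.8] -/
theorem highRoof_poly {η s : ℝ} (hη : 0 < η) (hη1 : η ≤ 1) (hs : 0 < s) (hs1 : s ≤ 1)
    {F : SpectralMap K} (hF : IsUniversalSpectralPoint K F) (hhigh : η ≤ specMMPoint K F 1) :
    (1 - s) * specMMPoint K F 1 ≤ (1 - specMMPoint K F 0) + 768 / (η ^ 4 * s ^ 4) * (1 - specMMPoint K F 2) := by
  obtain ⟨j, hj1, hj2⟩ := exists_dyadic_scale_poly hη hη1 hs hs1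
  have h := height_le_tower hF j
  have hε2 : 0 ≤ 1 - specMMPoint K F 2 := sub_nonneg.2 (AlmanLi2026.prop42_mem_Icc hF 2).2
  have h3 : 3 * (15 : ℝ) ^ j * (1 - specMMPoint K F 2) ≤ 768 / (η ^ 4 * s ^ 4) * (1 - specMMPoint K F 2) :=
    mul_le_mul_of_nonneg_right hj2 hε2
  have h4 : η * s ≤ s * specMMPoint K F 1 := by nlinarith [mul_le_mul_of_nonneg_left hhigh hs.le]
  nlinarith [h, h3, h4, hj1]

/-- ★ **High points obey every subexponential roof — `(t, c)` form**: for `0 < η ≤ 1` and `c > 0` put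
`t₀ := 1 − min 1 (c⁵η⁴/92160) < 1`; then for every `t ∈ [t₀, 1)` and every universal spectral point of height
`θ₁ ≥ η`: `t·θ₁ ≤ (1 − θ₀) + exp(c/(1−t))·(1 − θ₂)`. [cite: LottiRomani1983, Prop. 4.1] [cite: Strassen1988, Thm. 3.8] -/
theorem highRoof_subexp_t {η c : ℝ} (hη : 0 < η) (hη1 : η ≤ 1) (hc : 0 < c) {t : ℝ}
    (ht₀ : 1 - min 1 (c ^ 5 * η ^ 4 / 92160) ≤ t) (ht1 : t < 1)
    {F : SpectralMap K} (hF : IsUniversalSpectralPoint K F) (hhigh : η ≤ specMMPoint K F 1) :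
    t * specMMPoint K F 1 ≤ (1 - specMMPoint K F 0) + Real.exp (c / (1 - t)) * (1 - specMMPoint K F 2) := by
  have hs : 0 < 1 - t := by linarith
  have hmin1 := min_le_left (1 : ℝ) (c ^ 5 * η ^ 4 / 92160)
  have hmin2 := min_le_right (1 : ℝ) (c ^ 5 * η ^ 4 / 92160)
  have hs1 : 1 - t ≤ 1 := by linarith
  have hsc : 92160 * (1 - t) ≤ c ^ 5 * η ^ 4 := by
    have : 1 - t ≤ c ^ 5 * η ^ 4 / 92160 := by linarith
    linarith [(le_div_iff₀ (by norm_num : (0 : ℝ) < 92160)).1 this]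
  have h := highRoof_subexp hη hη1 hc hs hs1 hsc hF hhigh
  have e : (1 - (1 - t)) = t := by ring
  rwa [e] at h

end Summit.MatrixMultiplication.MatrixMultiplication.Theorems.SaturationLadderThinRoof

end
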